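import Summits.ResolutionOfSingularities.ResolutionOfSingularities.Theorems.EquisingularLiftEquisingularLiftNatHorizChain
import Summits.ResolutionOfSingularities.ResolutionOfSingularities.Theorems.EquisingularLiftEquisingularLiftReducedStrictTransformBlowup
import Summits.ResolutionOfSingularities.ResolutionOfSingularities.Theorems.EquisingularLiftCampaignW45bELNatAt
import Literature.AlgebraicGeometry.Resolution.BlowupsExistence
import Literature.AlgebraicGeometry.Resolution.ResolutionGlue
import HarnessLib

/-!
# [OURS · L1 W4.5(b)] EL♮ — THE ONE-STEP TRANSPORT ADAPTER (res-L1-w45b-plan-1 ORDERS 05:49:16Z (R0) / AMENDMENT 1 (R0′))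
# crux `Theses.EquisingularLift.EquisingularLiftNat` (stmt-ResolutionOfSingularities-20038), line `sections`

NOT a statement of any manuscript; OURS structural plumbing (cell `res-hironaka`, chain w45b, seat res-D-pv-022).
AI-written, weaker than expert review.

Every positive rung of the `n = 3` stubs of EL♮ has the shape «exhibit one more admissible HORIZONTAL E1 step and check
that the DOWNSTAIRS blow-up is regular». This file states that transport ONCE, in the setting of
`natChain_and_isIrreducible_of_horizChainE1` (p500485: `O` a DVR, `q : P → Spec O` smooth proper with integral
scheme-theoretic special fibre, `Y` irreducible closed inside the special fibre):

* `oneStep_horizChainE1` — for a stage `(P′, σ, Y′)` in the HORIZONTAL-E1 closure of `(P, 𝟙, Y)` and ONE more step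
  datum `(C, τ : P″ → P′)` (`IsBlowup τ C`, `V(C)` regular, `V(C) → Spec O` flat, `σ(V(C))` off the generic point of
  `Y`, special-fibre points of `V(C)` inside `Y′`) together with the DOWNSTAIRS hypothesis «some blow-up of the reduced
  `V(closure Y′)_red` along the trace `C · 𝒪` is regular», the new stage `(P″, τ ≫ σ, S″)`,
  `S″ = closure τ⁻¹(Y′ ∖ V(C))`, is again in the horizontal-E1 closure, satisfies the ITEM's E1-chain clause, has
  irreducible special fibre, and `V(closure S″)_red` is regular. Engine: p500485 (chain + irreducibility), the DL lemma
  `StrataSplit.exists_isBlowup_reducedStrictTransform` (p167331, Stacks 080E: the reduced strict transform IS a blow-up of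
  `V(closure Y′)_red` along the trace) and blow-up uniqueness (`IsBlowup.unique`) to move regularity; `closure Y′` is
  irreducible and `⊄ V(C)` by `Split.Chain.fibre` (the point of `Y′` over the generic point of `Y`).
* `oneStep_horizChainE1_of_forall` — the same with the downstairs hypothesis in `∀`-form («every blow-up … is regular»;
  a blow-up exists by `exists_isBlowup`).
* `elNatBody_of_oneStep₀` / `elNatOver_of_oneStep₀` — the LEVEL-0 corollary in the item's `q`-spelling
  (`P = ℙⁿ_O = Proj O[x₀..xₙ]`, `σ = 𝟙`, `Y = (ι ≫ Proj.map φ)(H)`), with the downstairs hypothesis moved to `H` itself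
  («every blow-up of `H` along `Λ · 𝒪_H` is regular», `Λ = C · 𝒪_{ℙⁿ_k}`) and the two set-theoretic clauses
  `ι(H) ⊄ V(Λ)` (off-generic) and `V(Λ) ⊆ ι(H)` (E1), concluding the `∃ (P′, σ, S′)` body of
  `Theorems.EquisingularLift.ELNatOver` (p503491) — the shape the specimens (R2: Whitney cubic; T-ORD; T-ISO) consume.

References: p500485 / p167331 docstrings; Liu 2002 Thm 8.1.19; Stacks 080E, 0806; ORDERS 05:49:16Z (R0), AMENDMENT 1 (R0′).
-/

set_option linter.dupNamespace false -- mandated namespace `Summit.<Summit>.<Problem>` of this single-conjunct summit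
set_option linter.overlappingInstances false -- signatures carry `[IsDomain O] [IsDiscreteValuationRing O]`

noncomputable section

open CategoryTheory CategoryTheory.Limits AlgebraicGeometry TopologicalSpace Topology
open MvPolynomial
open Literature.AlgebraicGeometry.Resolution
open AlgebraicGeometry.Scheme.IdealSheafData
open Summit.ResolutionOfSingularities.ResolutionOfSingularities.Theses.EquisingularLift.Split
open Summit.ResolutionOfSingularities.ResolutionOfSingularities.Cruxes.EquisingularLift.StrataSplit

attribute [local instance] MvPolynomial.gradedAlgebra

namespace Summit.ResolutionOfSingularities.ResolutionOfSingularities.Cruxes.EquisingularLiftNat.Sections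

/-! ## The one-step transport at a general stage -/

/-- **ONE MORE HORIZONTAL E1 STEP (general stage).** In the setting of p500485 let `(P′, σ, Y′)` lie in the horizontal-E1
closure of `(P, 𝟙, Y)` and let `(C, τ : P″ → P′)` be one more step: `τ` a blow-up along `C`, `V(C)` regular and flat
over `Spec O`, `σ(V(C))` off the generic point of `Y`, the special-fibre points of `V(C)` inside `Y′`. If SOME blow-up
of the reduced closed subscheme `V(closure Y′)_red ⊆ P′` along the trace `C · 𝒪` is a regular scheme, then for
`S″ = closure τ⁻¹(Y′ ∖ V(C))`: `(P″, τ ≫ σ, S″)` is in the horizontal-E1 closure and in the item's E1-chain closure of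
`(P, 𝟙, Y)`, the special fibre of `P″ → Spec O` is irreducible, and `V(closure S″)_red` is regular (it is a blow-up of
`V(closure Y′)_red` along the same trace, Stacks 080E, hence isomorphic to the given regular one). [folklore;
Liu 2002 Thm 8.1.19, Stacks 080E] -/
theorem oneStep_horizChainE1 (O : Type) [CommRing O] [IsDomain O] [IsDiscreteValuationRing O]
    (P P' P'' : Scheme.{0}) (q : P ⟶ Spec (.of O)) (Y : Set P) (σ : P' ⟶ P) (Y' : Set P')
    (hsm : Smooth q) (hpr : IsProper q) (hint : IsIntegral (pullback q (Spec.map (CommRingCat.ofHom (IsLocalRing.residue O)))))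
    (hYirr : IsIrreducible Y) (hYcl : IsClosed Y) (hY : Y ⊆ q ⁻¹' {IsLocalRing.closedPoint O})
    (hH : ∀ Q : (∀ X' : Scheme.{0}, (X' ⟶ P) → Set X' → Prop), Q P (𝟙 P) Y →
      (∀ (X' X'' : Scheme.{0}) (σ' : X' ⟶ P) (Y' : Set X') (C : X'.IdealSheafData) (τ : X'' ⟶ X'),
        Q X' σ' Y' → IsBlowup τ C → Scheme.IsRegular C.subscheme → Flat (C.subschemeι ≫ σ' ≫ q) →
        σ' '' (C.support : Set X') ⊆ {x | ¬ IsGenericPoint x Y} → (C.support : Set X') ∩ (σ' ≫ q) ⁻¹' {IsLocalRing.closedPoint O} ⊆ Y' →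
        Q X'' (τ ≫ σ') (closure (τ ⁻¹' (Y' \ (C.support : Set X'))))) → Q P' σ Y')
    (C : P'.IdealSheafData) (τ : P'' ⟶ P') (hτ : IsBlowup τ C) (hCreg : Scheme.IsRegular C.subscheme)
    (hCflat : Flat (C.subschemeι ≫ σ ≫ q)) (himg : σ '' (C.support : Set P') ⊆ {x | ¬ IsGenericPoint x Y})
    (hE1 : (C.support : Set P') ∩ (σ ≫ q) ⁻¹' {IsLocalRing.closedPoint O} ⊆ Y')
    (hdown : ∃ (Z : Scheme.{0}) (ρ : Z ⟶ (vanishingIdeal (⟨closure Y', isClosed_closure⟩ : Closeds P')).subscheme),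
      IsBlowup ρ (C.comap (vanishingIdeal (⟨closure Y', isClosed_closure⟩ : Closeds P')).subschemeι) ∧
        Scheme.IsRegular Z) :
    (∀ Q : (∀ X' : Scheme.{0}, (X' ⟶ P) → Set X' → Prop), Q P (𝟙 P) Y →
      (∀ (X' X'' : Scheme.{0}) (σ' : X' ⟶ P) (Y' : Set X') (C : X'.IdealSheafData) (τ : X'' ⟶ X'),
        Q X' σ' Y' → IsBlowup τ C → Scheme.IsRegular C.subscheme → Flat (C.subschemeι ≫ σ' ≫ q) →
        σ' '' (C.support : Set X') ⊆ {x | ¬ IsGenericPoint x Y} → (C.support : Set X') ∩ (σ' ≫ q) ⁻¹' {IsLocalRing.closedPoint O} ⊆ Y' →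
        Q X'' (τ ≫ σ') (closure (τ ⁻¹' (Y' \ (C.support : Set X'))))) →
      Q P'' (τ ≫ σ) (closure (τ ⁻¹' (Y' \ (C.support : Set P'))))) ∧
    (∀ Q : (∀ X' : Scheme.{0}, (X' ⟶ P) → Set X' → Prop), Q P (𝟙 P) Y →
      (∀ (X' X'' : Scheme.{0}) (σ' : X' ⟶ P) (Y' : Set X') (C : X'.IdealSheafData) (τ : X'' ⟶ X'),
        Q X' σ' Y' → IsBlowup τ C → Scheme.IsRegular C.subscheme →
        σ' '' (C.support : Set X') ⊆ {x | ¬ IsGenericPoint x Y} → (C.support : Set X') ∩ (σ' ≫ q) ⁻¹' {IsLocalRing.closedPoint O} ⊆ Y' →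
        Q X'' (τ ≫ σ') (closure (τ ⁻¹' (Y' \ (C.support : Set X'))))) →
      Q P'' (τ ≫ σ) (closure (τ ⁻¹' (Y' \ (C.support : Set P'))))) ∧
    IsIrreducible (((τ ≫ σ) ≫ q) ⁻¹' {IsLocalRing.closedPoint O}) ∧
    Scheme.IsRegular (vanishingIdeal (⟨closure (closure (τ ⁻¹' (Y' \ (C.support : Set P')))),
      isClosed_closure⟩ : Closeds P'')).subscheme := by
  classical
  -- (1) the horizontal-E1 closure is closed under one more horizontal E1 step
  have hH'' : ∀ Q : (∀ X' : Scheme.{0}, (X' ⟶ P) → Set X' → Prop), Q P (𝟙 P) Y →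
      (∀ (X' X'' : Scheme.{0}) (σ' : X' ⟶ P) (Y' : Set X') (C : X'.IdealSheafData) (τ : X'' ⟶ X'),
        Q X' σ' Y' → IsBlowup τ C → Scheme.IsRegular C.subscheme → Flat (C.subschemeι ≫ σ' ≫ q) →
        σ' '' (C.support : Set X') ⊆ {x | ¬ IsGenericPoint x Y} → (C.support : Set X') ∩ (σ' ≫ q) ⁻¹' {IsLocalRing.closedPoint O} ⊆ Y' →
        Q X'' (τ ≫ σ') (closure (τ ⁻¹' (Y' \ (C.support : Set X'))))) →
      Q P'' (τ ≫ σ) (closure (τ ⁻¹' (Y' \ (C.support : Set P')))) := fun Q h0 hstep =>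
    hstep P' P'' σ Y' C τ (hH Q h0 hstep) hτ hCreg hCflat himg hE1
  -- (2) E1 chain of the item and irreducibility of the last special fibre (p500485)
  obtain ⟨hchain, hirr⟩ := natChain_and_isIrreducible_of_horizChainE1 O P P'' q Y (τ ≫ σ)
    (closure (τ ⁻¹' (Y' \ (C.support : Set P')))) hsm hpr hint hYirr hYcl hY hH''
  refine ⟨hH'', hchain, hirr, ?_⟩
  -- (3) regularity of the reduced strict transform, moved from the given regular blow-up
  have hN : IsLocallyNoetherian P := by
    haveI := hsm
    exact LocallyOfFiniteType.isLocallyNoetherian q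
  have key := hH (fun X' σ' Y' => IsLocallyNoetherian X' ∧ Chain P Y X' σ' Y') ⟨hN, fun Q h0 _ => h0⟩ ?_
  swap
  · intro X' X'' σ' Y₁ C₁ τ₁ hQ hτ₁ hC₁ _ himg₁ _
    obtain ⟨hN₁, hch₁⟩ := hQ
    haveI := hN₁
    haveI : IsProper τ₁ := hτ₁.isProper
    exact ⟨LocallyOfFiniteType.isLocallyNoetherian τ₁,
      fun Q h0 hstep => hstep X' X'' σ' Y₁ C₁ τ₁ (hch₁ Q h0 hstep) hτ₁ hC₁ himg₁⟩
  obtain ⟨hN', hch⟩ := key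
  haveI := hN'
  haveI : IsProper τ := hτ.isProper
  haveI : IsLocallyNoetherian P'' := LocallyOfFiniteType.isLocallyNoetherian τ
  obtain ⟨ξ, hξ⟩ : ∃ ξ : P, IsGenericPoint ξ Y := QuasiSober.sober hYirr hYcl
  obtain ⟨ξ', hfib, hY'⟩ := Chain.fibre hch hξ
  have hσξ' : σ ξ' = ξ := by
    have : ξ' ∈ σ ⁻¹' {ξ} := by rw [hfib]; rfl
    simpa using this
  have hξ'C : ξ' ∉ (C.support : Set P') := fun h' => himg ⟨ξ', h', hσξ'⟩ hξ
  have hYc : closure Y' = Y' := by rw [hY', closure_closure]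
  have hirrY' : IsIrreducible (closure Y') := by
    rw [hY', closure_closure]
    exact isIrreducible_singleton.closure
  have hnot : ¬ closure Y' ⊆ (C.support : Set P') := fun h =>
    hξ'C (h (by rw [hYc, hY']; exact subset_closure rfl))
  obtain ⟨ρ₁, -, -, hρ₁⟩ :=
    exists_isBlowup_reducedStrictTransform P' P'' τ C hτ (closure Y') isClosed_closure hirrY' hnot
  obtain ⟨Z, ρ₀, hρ₀, hZ⟩ := hdown
  obtain ⟨e, -, -⟩ := hρ₀.unique hρ₁
  have hreg := hZ.of_iso e.hom
  have hT : (⟨closure (closure (τ ⁻¹' (Y' \ (C.support : Set P')))), isClosed_closure⟩ : Closeds P'') =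
      ⟨closure (τ ⁻¹' (closure Y' \ (C.support : Set P'))), isClosed_closure⟩ :=
    Closeds.ext (by
      change closure (closure (τ ⁻¹' (Y' \ (C.support : Set P')))) = closure (τ ⁻¹' (closure Y' \ (C.support : Set P')))
      rw [closure_closure, hYc])
  rw [hT]
  exact hreg

/-- **ONE MORE HORIZONTAL E1 STEP, `∀`-form of the downstairs hypothesis**: as `oneStep_horizChainE1`, assuming that
EVERY blow-up of `V(closure Y′)_red` along the trace `C · 𝒪` is regular (a blow-up exists, `exists_isBlowup`).
[folklore; Stacks 080E, 0806] -/
theorem oneStep_horizChainE1_of_forall (O : Type) [CommRing O] [IsDomain O] [IsDiscreteValuationRing O]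
    (P P' P'' : Scheme.{0}) (q : P ⟶ Spec (.of O)) (Y : Set P) (σ : P' ⟶ P) (Y' : Set P')
    (hsm : Smooth q) (hpr : IsProper q) (hint : IsIntegral (pullback q (Spec.map (CommRingCat.ofHom (IsLocalRing.residue O)))))
    (hYirr : IsIrreducible Y) (hYcl : IsClosed Y) (hY : Y ⊆ q ⁻¹' {IsLocalRing.closedPoint O})
    (hH : ∀ Q : (∀ X' : Scheme.{0}, (X' ⟶ P) → Set X' → Prop), Q P (𝟙 P) Y →
      (∀ (X' X'' : Scheme.{0}) (σ' : X' ⟶ P) (Y' : Set X') (C : X'.IdealSheafData) (τ : X'' ⟶ X'),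
        Q X' σ' Y' → IsBlowup τ C → Scheme.IsRegular C.subscheme → Flat (C.subschemeι ≫ σ' ≫ q) →
        σ' '' (C.support : Set X') ⊆ {x | ¬ IsGenericPoint x Y} → (C.support : Set X') ∩ (σ' ≫ q) ⁻¹' {IsLocalRing.closedPoint O} ⊆ Y' →
        Q X'' (τ ≫ σ') (closure (τ ⁻¹' (Y' \ (C.support : Set X'))))) → Q P' σ Y')
    (C : P'.IdealSheafData) (τ : P'' ⟶ P') (hτ : IsBlowup τ C) (hCreg : Scheme.IsRegular C.subscheme)
    (hCflat : Flat (C.subschemeι ≫ σ ≫ q)) (himg : σ '' (C.support : Set P') ⊆ {x | ¬ IsGenericPoint x Y})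
    (hE1 : (C.support : Set P') ∩ (σ ≫ q) ⁻¹' {IsLocalRing.closedPoint O} ⊆ Y')
    (hdown : ∀ (Z : Scheme.{0}) (ρ : Z ⟶ (vanishingIdeal (⟨closure Y', isClosed_closure⟩ : Closeds P')).subscheme),
      IsBlowup ρ (C.comap (vanishingIdeal (⟨closure Y', isClosed_closure⟩ : Closeds P')).subschemeι) →
        Scheme.IsRegular Z) :
    (∀ Q : (∀ X' : Scheme.{0}, (X' ⟶ P) → Set X' → Prop), Q P (𝟙 P) Y →
      (∀ (X' X'' : Scheme.{0}) (σ' : X' ⟶ P) (Y' : Set X') (C : X'.IdealSheafData) (τ : X'' ⟶ X'),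
        Q X' σ' Y' → IsBlowup τ C → Scheme.IsRegular C.subscheme → Flat (C.subschemeι ≫ σ' ≫ q) →
        σ' '' (C.support : Set X') ⊆ {x | ¬ IsGenericPoint x Y} → (C.support : Set X') ∩ (σ' ≫ q) ⁻¹' {IsLocalRing.closedPoint O} ⊆ Y' →
        Q X'' (τ ≫ σ') (closure (τ ⁻¹' (Y' \ (C.support : Set X'))))) →
      Q P'' (τ ≫ σ) (closure (τ ⁻¹' (Y' \ (C.support : Set P'))))) ∧
    (∀ Q : (∀ X' : Scheme.{0}, (X' ⟶ P) → Set X' → Prop), Q P (𝟙 P) Y →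
      (∀ (X' X'' : Scheme.{0}) (σ' : X' ⟶ P) (Y' : Set X') (C : X'.IdealSheafData) (τ : X'' ⟶ X'),
        Q X' σ' Y' → IsBlowup τ C → Scheme.IsRegular C.subscheme →
        σ' '' (C.support : Set X') ⊆ {x | ¬ IsGenericPoint x Y} → (C.support : Set X') ∩ (σ' ≫ q) ⁻¹' {IsLocalRing.closedPoint O} ⊆ Y' →
        Q X'' (τ ≫ σ') (closure (τ ⁻¹' (Y' \ (C.support : Set X'))))) →
      Q P'' (τ ≫ σ) (closure (τ ⁻¹' (Y' \ (C.support : Set P'))))) ∧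
    IsIrreducible (((τ ≫ σ) ≫ q) ⁻¹' {IsLocalRing.closedPoint O}) ∧
    Scheme.IsRegular (vanishingIdeal (⟨closure (closure (τ ⁻¹' (Y' \ (C.support : Set P')))),
      isClosed_closure⟩ : Closeds P'')).subscheme := by
  obtain ⟨Z, ρ, hρ⟩ := exists_isBlowup _
    (C.comap (vanishingIdeal (⟨closure Y', isClosed_closure⟩ : Closeds P')).subschemeι)
  exact oneStep_horizChainE1 O P P' P'' q Y σ Y' hsm hpr hint hYirr hYcl hY hH C τ hτ hCreg hCflat himg hE1
    ⟨Z, ρ, hρ, hdown Z ρ hρ⟩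


/-! ## Level 0 in the item's `q`-spelling: the first step out of `(ℙⁿ_O, 𝟙, Y)`, downstairs hypothesis on `H` -/

/-- **THE FIRST HORIZONTAL E1 STEP OUT OF `ℙⁿ_O`, downstairs on `H`.** Let `O` be a DVR with a surjection
`π : O → k` onto a field, `ι : H → ℙⁿ_k` a closed immersion of an integral scheme, `φ : O[x] → k[x]` a graded map
inducing `MvPolynomial.map π`, `g = Proj φ : ℙⁿ_k → ℙⁿ_O` (the special fibre) and `Y = g(ι(H))`. Let `C` be an ideal
sheaf on `ℙⁿ_O` with `V(C)` regular and flat over `Spec O`, and put `Λ = C · 𝒪_{ℙⁿ_k} = C.comap g`. If `ι(H) ⊄ V(Λ)`,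
`V(Λ) ⊆ ι(H)`, and EVERY blow-up of `H` along `Λ · 𝒪_H = Λ.comap ι` is regular, then the `∃ (P′, σ, S′)` body of the
EL♮ item holds for `Y`: ONE blow-up `τ : P′ → ℙⁿ_O` along `C`, `S′ = closure τ⁻¹(Y ∖ V(C))`. (`oneStep_horizChainE1` at
the stage `(ℙⁿ_O, 𝟙, Y)`; `V(Y)_red ≅ H` since `H` is reduced; the special fibre is the range of `g`,
`ProjectiveAmbientFibre.isPullback_projMap`.) [folklore; Liu 2002 Thm 8.1.19, Prop. 3.1.9] -/
theorem elNatBody_of_oneStep₀ (O : Type) [CommRing O] [IsDomain O] [IsDiscreteValuationRing O]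
    (k : Type) [Field k] (π : O →+* k) (hπ : Function.Surjective π) (n : ℕ) (H : Scheme.{0})
    (ι : H ⟶ Proj (homogeneousSubmodule (Fin (n + 1)) k)) [IsClosedImmersion ι] [IsIntegral H]
    (φ : homogeneousSubmodule (Fin (n + 1)) O →+*ᵍ homogeneousSubmodule (Fin (n + 1)) k)
    (hφ' : HomogeneousIdeal.irrelevant (homogeneousSubmodule (Fin (n + 1)) k) ≤
      (HomogeneousIdeal.irrelevant (homogeneousSubmodule (Fin (n + 1)) O)).map φ)
    (hφ : ∀ s, φ s = MvPolynomial.map π s)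
    (C : (Proj (homogeneousSubmodule (Fin (n + 1)) O)).IdealSheafData) (hCreg : Scheme.IsRegular C.subscheme)
    (hCflat : Flat (C.subschemeι ≫ Proj.toSpecZero (homogeneousSubmodule (Fin (n + 1)) O) ≫
      Spec.map (CommRingCat.ofHom (algebraMap O (homogeneousSubmodule (Fin (n + 1)) O 0)))))
    (hgen : ¬ (Set.range ι ⊆ ((C.comap (Proj.map φ hφ')).support : Set (Proj (homogeneousSubmodule (Fin (n + 1)) k)))))
    (hsupp : ((C.comap (Proj.map φ hφ')).support : Set (Proj (homogeneousSubmodule (Fin (n + 1)) k))) ⊆ Set.range ι)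
    (hdown : ∀ (Z : Scheme.{0}) (ρ : Z ⟶ H), IsBlowup ρ ((C.comap (Proj.map φ hφ')).comap ι) → Scheme.IsRegular Z) :
    ∀ Y : Set (Proj (homogeneousSubmodule (Fin (n + 1)) O)), Y = Set.range (ι ≫ Proj.map φ hφ') →
    ∃ (P' : Scheme.{0}) (σ : P' ⟶ Proj (homogeneousSubmodule (Fin (n + 1)) O)) (S' : Set P'),
      (∀ Q : (∀ X' : Scheme.{0}, (X' ⟶ Proj (homogeneousSubmodule (Fin (n + 1)) O)) → Set X' → Prop),
        Q (Proj (homogeneousSubmodule (Fin (n + 1)) O)) (𝟙 _) Y →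
        (∀ (X' X'' : Scheme.{0}) (σ' : X' ⟶ Proj (homogeneousSubmodule (Fin (n + 1)) O)) (Y' : Set X')
          (C : X'.IdealSheafData) (τ : X'' ⟶ X'), Q X' σ' Y' → IsBlowup τ C → Scheme.IsRegular C.subscheme →
          σ' '' (C.support : Set X') ⊆ {x | ¬ IsGenericPoint x Y} →
          (C.support : Set X') ∩ (σ' ≫ (Proj.toSpecZero (homogeneousSubmodule (Fin (n + 1)) O) ≫
            Spec.map (CommRingCat.ofHom (algebraMap O (homogeneousSubmodule (Fin (n + 1)) O 0))))) ⁻¹'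
            {IsLocalRing.closedPoint O} ⊆ Y' →
          Q X'' (τ ≫ σ') (closure (τ ⁻¹' (Y' \ (C.support : Set X'))))) → Q P' σ S') ∧
      IsIrreducible ((σ ≫ (Proj.toSpecZero (homogeneousSubmodule (Fin (n + 1)) O) ≫
        Spec.map (CommRingCat.ofHom (algebraMap O (homogeneousSubmodule (Fin (n + 1)) O 0))))) ⁻¹'
        {IsLocalRing.closedPoint O}) ∧
      Scheme.IsRegular (vanishingIdeal (⟨closure S', isClosed_closure⟩ : Closeds P')).subscheme := by
  classical
  set q : (Proj (homogeneousSubmodule (Fin (n + 1)) O)) ⟶ Spec (.of O) := Proj.toSpecZero (homogeneousSubmodule (Fin (n + 1)) O) ≫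
    Spec.map (CommRingCat.ofHom (algebraMap O (homogeneousSubmodule (Fin (n + 1)) O 0))) with hqdef
  set g : Proj (homogeneousSubmodule (Fin (n + 1)) k) ⟶ (Proj (homogeneousSubmodule (Fin (n + 1)) O)) := Proj.map φ hφ' with hgdef
  set Λ : (Proj (homogeneousSubmodule (Fin (n + 1)) k)).IdealSheafData := C.comap g with hΛdef
  intro Y hY
  -- the special fibre is the range of the closed immersion `g`
  have hP := ProjectiveAmbientFibre.isPullback_projMap π φ hφ hπ hφ'
  haveI : IsClosedImmersion (Spec.map (CommRingCat.ofHom π)) := IsClosedImmersion.spec_of_surjective _ hπ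
  haveI : IsClosedImmersion g := MorphismProperty.IsStableUnderBaseChange.of_isPullback hP.flip inferInstance
  have hpt : ∀ x : Spec (.of k), Spec.map (CommRingCat.ofHom π) x = IsLocalRing.closedPoint O := by
    intro x
    rw [Spec.map_apply]
    apply PrimeSpectrum.ext
    rw [PrimeSpectrum.comap_asIdeal, CommRingCat.hom_ofHom, Ideal.eq_bot_of_prime x.asIdeal, ← RingHom.ker_eq_comap_bot]
    exact IsLocalRing.eq_maximalIdeal (RingHom.ker_isMaximal_of_surjective π hπ)
  have hgq : ∀ x, q (g x) = IsLocalRing.closedPoint O := fun x ↦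
    (Scheme.Hom.comp_apply g q x).symm.trans
      ((congrArg (fun h : Proj (homogeneousSubmodule (Fin (n + 1)) k) ⟶ Spec (.of O) ↦ h x) hP.w).trans
        ((Scheme.Hom.comp_apply _ _ x).trans (hpt _)))
  have hrange : Set.range g = q ⁻¹' {IsLocalRing.closedPoint O} := by
    refine Set.ext fun y ↦ ⟨?_, fun hy ↦ ?_⟩
    · rintro ⟨x, rfl⟩
      exact hgq x
    · have hy' : q y = IsLocalRing.closedPoint O := hy
      obtain ⟨x, hx, -⟩ := Scheme.exists_preimage_of_isPullback hP y default (hy'.trans (hpt default).symm)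
      exact ⟨x, hx⟩
  -- the closed immersion `f = ι ≫ g` and its range `Y`
  let f : H ⟶ (Proj (homogeneousSubmodule (Fin (n + 1)) O)) := ι ≫ g
  have hYf : Y = Set.range f := hY
  have hYcl : IsClosed Y := by rw [hYf]; exact f.isClosedEmbedding.isClosed_range
  have hYs : Y ⊆ q ⁻¹' {IsLocalRing.closedPoint O} := by
    rw [hYf]
    rintro _ ⟨x, rfl⟩
    change q ((ι ≫ g) x) = _
    rw [Scheme.Hom.comp_apply]
    exact hgq _
  have hgenY : IsGenericPoint (f (genericPoint H)) Y := by
    have h := (genericPoint_spec H).image f.continuous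
    rwa [Set.image_univ, f.isClosedEmbedding.isClosed_range.closure_eq, ← hYf] at h
  have hYirr : IsIrreducible Y := by
    have h := (isIrreducible_singleton (x := f (genericPoint H))).closure
    rwa [hgenY] at h
  have hgenι : IsGenericPoint (ι (genericPoint H)) (Set.range ι) := by
    have h := (genericPoint_spec H).image ι.continuous
    rwa [Set.image_univ, ι.isClosedEmbedding.isClosed_range.closure_eq] at h
  -- `V(Y)_red ≅ H` (a closed immersion from a reduced scheme has kernel the vanishing ideal sheaf of its range)
  let T : Closeds (Proj (homogeneousSubmodule (Fin (n + 1)) O)) := ⟨Y, hYcl⟩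
  have hYker : vanishingIdeal T = f.ker := by
    rw [← Scheme.IdealSheafData.map_bot, ← Scheme.nilradical_eq_bot, ← Scheme.IdealSheafData.vanishingIdeal_top,
      Scheme.IdealSheafData.map_vanishingIdeal]
    congr 1
    ext1
    change Y = closure (f '' Set.univ)
    rw [Set.image_univ, f.isClosedEmbedding.isClosed_range.closure_eq, hYf]
  have hker : (vanishingIdeal T).subschemeι.ker = f.ker := by
    rw [Scheme.IdealSheafData.ker_subschemeι, hYker]
  let e : H ⟶ (vanishingIdeal T).subscheme := IsClosedImmersion.lift _ f hker.le
  have he : e ≫ (vanishingIdeal T).subschemeι = f := IsClosedImmersion.lift_fac _ f hker.le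
  haveI : IsIso e := IsClosedImmersion.isIso_lift _ f hker
  -- preimages along `g`
  have hpreC : g ⁻¹' (C.support : Set (Proj (homogeneousSubmodule (Fin (n + 1)) O))) = (Λ.support : Set (Proj (homogeneousSubmodule (Fin (n + 1)) k))) := by
    have h := Scheme.IdealSheafData.support_comap C g
    rw [h]
    rfl
  -- the step hypotheses at level 0
  have hCflat' : Flat (C.subschemeι ≫ 𝟙 (Proj (homogeneousSubmodule (Fin (n + 1)) O)) ≫ q) := by rw [Category.id_comp]; exact hCflat
  have himg : (𝟙 (Proj (homogeneousSubmodule (Fin (n + 1)) O)) : (Proj (homogeneousSubmodule (Fin (n + 1)) O)) ⟶ (Proj (homogeneousSubmodule (Fin (n + 1)) O))) '' (C.support : Set (Proj (homogeneousSubmodule (Fin (n + 1)) O))) ⊆ {x : (Proj (homogeneousSubmodule (Fin (n + 1)) O)) | ¬ IsGenericPoint x Y} := by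
    rintro _ ⟨x, hx, rfl⟩ hgx
    change IsGenericPoint x Y at hgx
    have hxe : x = f (genericPoint H) := hgx.eq hgenY
    have hmem : ι (genericPoint H) ∈ g ⁻¹' (C.support : Set (Proj (homogeneousSubmodule (Fin (n + 1)) O))) := by
      change g (ι (genericPoint H)) ∈ (C.support : Set (Proj (homogeneousSubmodule (Fin (n + 1)) O)))
      rw [← Scheme.Hom.comp_apply, ← hxe]
      exact hx
    rw [hpreC] at hmem
    apply hgen
    rw [← hgenι]
    exact closure_minimal (Set.singleton_subset_iff.mpr hmem) Λ.support.isClosed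
  have hE1 : (C.support : Set (Proj (homogeneousSubmodule (Fin (n + 1)) O))) ∩ (𝟙 (Proj (homogeneousSubmodule (Fin (n + 1)) O)) ≫ q) ⁻¹' {IsLocalRing.closedPoint O} ⊆ Y := by
    rintro x ⟨hxC, hxq⟩
    rw [Category.id_comp] at hxq
    have hxg : x ∈ Set.range g := by rw [hrange]; exact hxq
    obtain ⟨x', rfl⟩ := hxg
    have hx' : x' ∈ (Λ.support : Set (Proj (homogeneousSubmodule (Fin (n + 1)) k))) := by rw [← hpreC]; exact hxC
    obtain ⟨h, hh⟩ := hsupp hx'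
    rw [hYf]
    exact ⟨h, by rw [← hh]; exact Scheme.Hom.comp_apply _ _ h⟩
  -- downstairs: a blow-up of `V(Y)_red` along `C · 𝒪`, transported from a blow-up of `H` along `Λ · 𝒪_H`
  have hdown' : ∃ (Z : Scheme.{0}) (ρ : Z ⟶ (vanishingIdeal (⟨closure Y, isClosed_closure⟩ : Closeds (Proj (homogeneousSubmodule (Fin (n + 1)) O)))).subscheme),
      IsBlowup ρ (C.comap (vanishingIdeal (⟨closure Y, isClosed_closure⟩ : Closeds (Proj (homogeneousSubmodule (Fin (n + 1)) O)))).subschemeι) ∧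
        Scheme.IsRegular Z := by
    have hTc : (⟨closure Y, isClosed_closure⟩ : Closeds (Proj (homogeneousSubmodule (Fin (n + 1)) O))) = T := Closeds.ext (by
      change closure Y = Y
      exact hYcl.closure_eq)
    rw [hTc]
    have hcomp : (C.comap (vanishingIdeal T).subschemeι).comap e = Λ.comap ι := by
      rw [← Scheme.IdealSheafData.comap_comp, he]
      simp only [f, Scheme.IdealSheafData.comap_comp, hΛdef]
    obtain ⟨Z, ρ, hρ⟩ := exists_isBlowup H (Λ.comap ι)
    have hZ : Scheme.IsRegular Z := hdown Z ρ hρ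
    rw [← hcomp] at hρ
    have hρ' := hρ.comp_iso (asIso e)
    have hid : ((C.comap (vanishingIdeal T).subschemeι).comap e).comap (asIso e).inv =
        C.comap (vanishingIdeal T).subschemeι := by
      rw [← Scheme.IdealSheafData.comap_comp, asIso_inv, IsIso.inv_hom_id, Scheme.IdealSheafData.comap_id]
    rw [hid] at hρ'
    exact ⟨Z, ρ ≫ (asIso e).hom, hρ', hZ⟩
  have hH0 : ∀ Q : (∀ X' : Scheme.{0}, (X' ⟶ (Proj (homogeneousSubmodule (Fin (n + 1)) O))) → Set X' → Prop), Q (Proj (homogeneousSubmodule (Fin (n + 1)) O)) (𝟙 (Proj (homogeneousSubmodule (Fin (n + 1)) O))) Y →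
      (∀ (X' X'' : Scheme.{0}) (σ' : X' ⟶ (Proj (homogeneousSubmodule (Fin (n + 1)) O))) (Y' : Set X') (C : X'.IdealSheafData) (τ : X'' ⟶ X'),
        Q X' σ' Y' → IsBlowup τ C → Scheme.IsRegular C.subscheme → Flat (C.subschemeι ≫ σ' ≫ q) →
        σ' '' (C.support : Set X') ⊆ {x | ¬ IsGenericPoint x Y} → (C.support : Set X') ∩ (σ' ≫ q) ⁻¹' {IsLocalRing.closedPoint O} ⊆ Y' →
        Q X'' (τ ≫ σ') (closure (τ ⁻¹' (Y' \ (C.support : Set X'))))) → Q (Proj (homogeneousSubmodule (Fin (n + 1)) O)) (𝟙 (Proj (homogeneousSubmodule (Fin (n + 1)) O))) Y := fun Q h0 _ => h0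
  obtain ⟨hsm, hpr⟩ := stub_projectiveAmbientSmoothProper O n
  have hint := isIntegral_specialFibre_projectiveSpace O n
  obtain ⟨P', τ, hτ⟩ := exists_isBlowup (Proj (homogeneousSubmodule (Fin (n + 1)) O)) C
  obtain ⟨-, hchain, hirr, hreg⟩ := oneStep_horizChainE1 O (Proj (homogeneousSubmodule (Fin (n + 1)) O)) (Proj (homogeneousSubmodule (Fin (n + 1)) O)) P' q Y (𝟙 (Proj (homogeneousSubmodule (Fin (n + 1)) O))) Y hsm hpr hint hYirr hYcl hYs hH0 C τ hτ
    hCreg hCflat' himg hE1 hdown'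
  refine ⟨P', τ ≫ 𝟙 (Proj (homogeneousSubmodule (Fin (n + 1)) O)), closure (τ ⁻¹' (Y \ (C.support : Set (Proj (homogeneousSubmodule (Fin (n + 1)) O))))), hchain, hirr, hreg⟩


/-- **`ELNatOver` FROM ONE HORIZONTAL E1 STEP OUT OF `ℙⁿ_O`.** For an integral `H` with a closed immersion
`ι : H → ℙⁿ_k`, a characteristic-0 DVR `O` with a surjection `π : O → k`, an ideal sheaf `C` on `ℙⁿ_O` with `V(C)`
regular and `O`-flat, and an ideal sheaf `Λ` on `ℙⁿ_k` with `C · 𝒪_{ℙⁿ_k} = Λ` along EVERY graded `φ` inducing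
`MvPolynomial.map π`: if `ι(H) ⊄ V(Λ) ⊆ ι(H)` and every blow-up of `H` along `Λ · 𝒪_H` is regular, then
`ELNatOver p k n H ι O π` (p503491) — EL♮ for this `H` over this `(O, π)`, by ONE blow-up of `ℙⁿ_O` along `C`.
[folklore] -/
theorem elNatOver_of_oneStep₀ {p : ℕ} (k : Type) [Field k] [CharP k p] [IsAlgClosed k] (n : ℕ) (H : Scheme.{0})
    (ι : H ⟶ (Literature.AlgebraicGeometry.Motives.projectiveSpace n k).left) [IsClosedImmersion ι] [IsIntegral H]
    (O : Type) [CommRing O] [IsDomain O] [IsDiscreteValuationRing O] [CharZero O] (π : O →+* k)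
    (hπ : Function.Surjective π)
    (C : (Proj (homogeneousSubmodule (Fin (n + 1)) O)).IdealSheafData) (hCreg : Scheme.IsRegular C.subscheme)
    (hCflat : Flat (C.subschemeι ≫ Proj.toSpecZero (homogeneousSubmodule (Fin (n + 1)) O) ≫
      Spec.map (CommRingCat.ofHom (algebraMap O (homogeneousSubmodule (Fin (n + 1)) O 0)))))
    (Λ : (Proj (homogeneousSubmodule (Fin (n + 1)) k)).IdealSheafData)
    (hKEY : ∀ (φ : homogeneousSubmodule (Fin (n + 1)) O →+*ᵍ homogeneousSubmodule (Fin (n + 1)) k)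
      (hφ' : HomogeneousIdeal.irrelevant (homogeneousSubmodule (Fin (n + 1)) k) ≤
        (HomogeneousIdeal.irrelevant (homogeneousSubmodule (Fin (n + 1)) O)).map φ),
      (∀ s, φ s = MvPolynomial.map π s) → C.comap (Proj.map φ hφ') = Λ)
    (hgen : ¬ (Set.range ι ⊆ (Λ.support : Set (Proj (homogeneousSubmodule (Fin (n + 1)) k)))))
    (hsupp : (Λ.support : Set (Proj (homogeneousSubmodule (Fin (n + 1)) k))) ⊆ Set.range ι)
    (hdown : ∀ (Z : Scheme.{0}) (ρ : Z ⟶ H), IsBlowup ρ (Λ.comap ι) → Scheme.IsRegular Z) :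
    Theorems.EquisingularLift.ELNatOver p k n H ι O π := by
  intro φ hφ' hφ Y hY
  let ι' : H ⟶ Proj (homogeneousSubmodule (Fin (n + 1)) k) := ι
  haveI : IsClosedImmersion ι' := ‹IsClosedImmersion ι›
  have hK := hKEY φ hφ' hφ
  exact elNatBody_of_oneStep₀ O k π hπ n H ι' φ hφ' hφ C hCreg hCflat (by rw [hK]; exact hgen)
    (by rw [hK]; exact hsupp) (fun Z ρ hρ => hdown Z ρ (by rw [hK] at hρ; exact hρ)) Y hY

/-- **`ELNatAt` FROM ONE HORIZONTAL E1 STEP** — the same packaged with `elNatAt_of_elNatOver`. [folklore] -/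
theorem elNatAt_of_oneStep₀ {p : ℕ} (k : Type) [Field k] [CharP k p] [IsAlgClosed k] (n : ℕ) (H : Scheme.{0})
    (ι : H ⟶ (Literature.AlgebraicGeometry.Motives.projectiveSpace n k).left) [IsClosedImmersion ι] [IsIntegral H]
    (O : Type) [CommRing O] [IsDomain O] [IsDiscreteValuationRing O] [CharZero O] (π : O →+* k)
    (hπ : Function.Surjective π)
    (C : (Proj (homogeneousSubmodule (Fin (n + 1)) O)).IdealSheafData) (hCreg : Scheme.IsRegular C.subscheme)
    (hCflat : Flat (C.subschemeι ≫ Proj.toSpecZero (homogeneousSubmodule (Fin (n + 1)) O) ≫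
      Spec.map (CommRingCat.ofHom (algebraMap O (homogeneousSubmodule (Fin (n + 1)) O 0)))))
    (Λ : (Proj (homogeneousSubmodule (Fin (n + 1)) k)).IdealSheafData)
    (hKEY : ∀ (φ : homogeneousSubmodule (Fin (n + 1)) O →+*ᵍ homogeneousSubmodule (Fin (n + 1)) k)
      (hφ' : HomogeneousIdeal.irrelevant (homogeneousSubmodule (Fin (n + 1)) k) ≤
        (HomogeneousIdeal.irrelevant (homogeneousSubmodule (Fin (n + 1)) O)).map φ),
      (∀ s, φ s = MvPolynomial.map π s) → C.comap (Proj.map φ hφ') = Λ)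
    (hgen : ¬ (Set.range ι ⊆ (Λ.support : Set (Proj (homogeneousSubmodule (Fin (n + 1)) k)))))
    (hsupp : (Λ.support : Set (Proj (homogeneousSubmodule (Fin (n + 1)) k))) ⊆ Set.range ι)
    (hdown : ∀ (Z : Scheme.{0}) (ρ : Z ⟶ H), IsBlowup ρ (Λ.comap ι) → Scheme.IsRegular Z) :
    Theorems.EquisingularLift.ELNatAt p k n H ι :=
  Theorems.EquisingularLift.elNatAt_of_elNatOver hπ
    (elNatOver_of_oneStep₀ k n H ι O π hπ C hCreg hCflat Λ hKEY hgen hsupp hdown)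

end Summit.ResolutionOfSingularities.ResolutionOfSingularities.Cruxes.EquisingularLiftNat.Sections

end
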